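import Literature.Topology.FourManifolds.BandSumUnitPolarModel
import HarnessLib

/-!
# The unknot is a unit for the connected sum — polar/inversion model, II: band coordinates

Topic `Literature/Topology/FourManifolds`; sequel of `BandSumUnitPolarModel.lean` (seat-B line of the
discharge of `Literature.Topology.FourManifolds.Knot.exists_isConnectedSum_unknot_isIsotopic`,
Rolfsen (1976), §2.G). The band coordinates `x = (x₀, x₁) ∈ ℝ²` of the polar rectangle are

* the radius `rr x₀ = 1 + 9 x₀` (`0 ↦ 1` unit circle / unknot, `1/2 ↦ 11/2` splitting circle,
  `1 ↦ 10` the line) and the window angle `θw x₁ = -π - 2/5 + κ (x₁ + 1/10)`, `κ = (π + 4/5)/(6/5)`,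
  mapping the collar `(-1/10, 11/10)` onto `(-π - 2/5, 2/5)`, with period `per = 2π/κ` in `x₁`;
* the model coordinates `mU x = U (rr x₀) (θw x₁)`, `mW x = W (rr x₀) (θw x₁)` and the packaged map
  `mpt x = (mU x, mW x)`.

Proved here: smoothness (`contDiff_mU`, `contDiff_mW`, `contDiff_mpt`), periodicity in `x₁`
(`mU_add_per`, `mW_add_per`), the differentials on the region (`fderiv_mU_apply`, `fderiv_mW_apply`:
`d(mU) v = Ur · 9 v₀ + Uθ · κ v₁`), **immersion** (`injective_fderiv_mpt`) and **injectivity**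
(`mpt_injOn_aux`, `rr_eq_and_of_eq`) on the enlarged closed collar
`[-1/10, 11/10] × [-1/10 - 1/(10κ), 11/10 + 1/(10κ)]` (angles in `[-π - 1/2, 1/2]`, where `sin ≤ 1/2`
and `Q > 10`: `sin_θw_le`, `ten_lt_Q_rr`), and the edges: the right edge `x₀ = 1` lies on the line
`mW = 0` and nothing else of the region does (`mW_eq_zero_iff`, `mW_pt2_one`, `mU_pt2_one`,
`strictMonoOn_mU_one`), the left edge `x₀ = 0` lies on the round circle `O_c` and nothing else of
the region does (`mem_circle_iff`, `pt2_zero_mem_circle`), the middle line `x₀ = 1/2` is exactly the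
intersection with the splitting circle (`mem_splitCircle_iff`) and the unit circle is inside it
(`pt2_zero_inside`); finally the trigonometry of the two end windows (`cos_pos_right`,
`sin_ge_right`, `cos_neg_left`, `sin_ge_left`, `sin_θw_le_two_fifths`).

## References

* D. Rolfsen, *Knots and Links*, Publish or Perish (1976), §2.G (the consumer). [Rolfsen1976]

## Design notes

Everything is `[folklore]`; no named facts, no `sorry`. `pt2`, `squareNhd` are those of `BandSum.lean`
(via `PlanarArch.lean`).
-/

open scoped ContDiff Topology Real
open Function Set Real

noncomputable section

namespace Literature.Topology.FourManifolds

namespace BandSumUnit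

namespace Polar

/-! ### The band coordinates -/

/-- The angular scale `κ = (π + 4/5)/(6/5)` of the window. [folklore] -/
def kap : ℝ := (π + 4 / 5) / (6 / 5)

/-- The angular scale is positive. [folklore] -/
theorem kap_pos : 0 < kap := by rw [kap]; positivity

/-- **The window angle** `θ(x₁) = -π - 2/5 + κ (x₁ + 1/10)`: the collar `(-1/10, 11/10)` goes onto
`(-π - 2/5, 2/5)`. [folklore] -/
def θw (x₁ : ℝ) : ℝ := -π - 2 / 5 + kap * (x₁ + 1 / 10)

/-- **The radius** `r(x₀) = 1 + 9 x₀`: `0 ↦ 1` (unit circle), `1/2 ↦ 11/2` (splitting circle),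
`1 ↦ 10` (the circle through the centre of inversion, i.e. the line). [folklore] -/
def rr (x₀ : ℝ) : ℝ := 1 + 9 * x₀

/-- `r(0) = 1`. [folklore] -/
@[simp] theorem rr_zero : rr 0 = 1 := by norm_num [rr]
/-- `r(1) = 10`. [folklore] -/
@[simp] theorem rr_one : rr 1 = 10 := by norm_num [rr]
/-- `r(1/2) = 11/2`. [folklore] -/
@[simp] theorem rr_half : rr 2⁻¹ = 11 / 2 := by norm_num [rr]

/-- `r(x₀) = a ↔ x₀ = (a - 1)/9`. [folklore] -/
theorem rr_eq_iff {x₀ a : ℝ} : rr x₀ = a ↔ x₀ = (a - 1) / 9 := by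
  rw [rr]; constructor <;> intro h <;> linarith

/-- The window angle at the left end of the collar: `θ(-1/10) = -π - 2/5`. [folklore] -/
theorem θw_neg_tenth : θw (-(1 / 10)) = -π - 2 / 5 := by rw [θw]; ring

/-- The window angle at the right end of the collar: `θ(11/10) = 2/5`. [folklore] -/
theorem θw_eleven_tenths : θw (11 / 10) = 2 / 5 := by
  rw [θw, kap]; field_simp; ring

/-- The window angle in the middle: `θ(1/2) = -π/2`. [folklore] -/
theorem θw_half : θw 2⁻¹ = -(π / 2) := by
  rw [θw, kap]; field_simp; ring

/-- The window angle has derivative `κ`. [folklore] -/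
theorem hasDerivAt_θw (x₁ : ℝ) : HasDerivAt θw kap x₁ := by
  have h := (((hasDerivAt_id x₁).add_const (1 / 10)).const_mul kap).const_add (-π - 2 / 5)
  rw [mul_one] at h
  exact h

/-- The radius has derivative `9`. [folklore] -/
theorem hasDerivAt_rr (x₀ : ℝ) : HasDerivAt rr 9 x₀ := by
  unfold rr
  simpa using ((hasDerivAt_id x₀).const_mul 9).const_add 1

/-- The window angle is `C^∞`. [folklore] -/
theorem contDiff_θw : ContDiff ℝ ∞ θw := by
  unfold θw; fun_prop

/-- The radius is `C^∞`. [folklore] -/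
theorem contDiff_rr : ContDiff ℝ ∞ rr := by
  unfold rr; fun_prop

/-- The window angle is strictly increasing. [folklore] -/
theorem strictMono_θw : StrictMono θw := fun a b h ↦ by
  unfold θw; nlinarith [kap_pos]

/-- The radius is strictly increasing. [folklore] -/
theorem strictMono_rr : StrictMono rr := fun a b h ↦ by
  unfold rr; linarith

/-- The window angle is injective. [folklore] -/
theorem θw_injective : Injective θw := strictMono_θw.injective

/-- Angles of the closed collar lie in `[-π - 2/5, 2/5]`. [folklore] -/
theorem θw_mem {x₁ : ℝ} (h : x₁ ∈ Icc (-(1 / 10)) (11 / 10)) : θw x₁ ∈ Icc (-π - 2 / 5) (2 / 5) := by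
  rw [← θw_neg_tenth, ← θw_eleven_tenths]
  exact ⟨strictMono_θw.monotone h.1, strictMono_θw.monotone h.2⟩

/-- On the slightly enlarged collar the sine of the window angle is at most `1/2`. [folklore] -/
theorem sin_θw_le {x₁ : ℝ} (h : x₁ ∈ Icc (-(1 / 10) - (10 * kap)⁻¹) (11 / 10 + (10 * kap)⁻¹)) :
    sin (θw x₁) ≤ 1 / 2 := by
  have hk := kap_pos
  have h1 : -π - 1 / 2 ≤ θw x₁ := by
    have : θw (-(1 / 10) - (10 * kap)⁻¹) = -π - 1 / 2 := by
      rw [θw]; field_simp; ring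
    rw [← this]; exact strictMono_θw.monotone h.1
  have h2 : θw x₁ ≤ 1 / 2 := by
    have : θw (11 / 10 + (10 * kap)⁻¹) = 1 / 2 := by
      rw [θw, kap]; field_simp; ring
    rw [← this]; exact strictMono_θw.monotone h.2
  exact sin_le_half h1 h2

/-- The region condition on the enlarged collar: `Q > 10`. [folklore] -/
theorem ten_lt_Q_rr {x₀ θ : ℝ} (hx : x₀ ∈ Icc (-(1 / 10)) (11 / 10)) (hs : sin θ ≤ 1 / 2) :
    10 < Q (rr x₀) θ := by
  rcases le_or_gt (rr x₀) 1 with h | h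
  · have := Q_ge_of_le_one (r := rr x₀) (by rw [rr]; linarith [hx.1]) h (θ := θ); linarith
  · exact ten_lt_Q h hs

/-- The radius is positive on `[-1/10, ∞)`. [folklore] -/
theorem rr_pos {x₀ : ℝ} (hx : -(1 / 10) ≤ x₀) : 0 < rr x₀ := by rw [rr]; linarith

/-- The period `P = 2π/κ` of the band coordinates in `x₁`. [folklore] -/
def per : ℝ := 2 * π / kap

/-- The period is positive. [folklore] -/
theorem per_pos : 0 < per := by rw [per]; exact div_pos (by positivity) kap_pos

/-- Shifting `x₁` by the period adds `2π` to the window angle. [folklore] -/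
theorem θw_add_per (x₁ : ℝ) : θw (x₁ + per) = θw x₁ + 2 * π := by
  rw [θw, θw, per]; field_simp [kap_pos.ne']; ring

/-- Shifting `x₁` back by the period subtracts `2π` from the window angle. [folklore] -/
theorem θw_sub_per (x₁ : ℝ) : θw (x₁ - per) = θw x₁ - 2 * π := by
  have := θw_add_per (x₁ - per); rw [sub_add_cancel] at this; linarith

/-- `per = 12π/(5π + 4)`, numerically `≈ 1.91`; we record `3/2 < per < 2`. [folklore] -/
theorem per_bounds : 3 / 2 < per ∧ per < 2 := by
  have hπ := pi_gt_three
  have hπ' := pi_lt_four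
  have hk := kap_pos
  rw [per]
  constructor
  · rw [lt_div_iff₀ hk, kap]; nlinarith
  · rw [div_lt_iff₀ hk, kap]; nlinarith

/-! ### The model band map on `ℝ²` -/

/-- First model coordinate in band coordinates `x = (x₀, x₁)`. [folklore] -/
def mU (x : EuclideanSpace ℝ (Fin 2)) : ℝ := U (rr (x 0)) (θw (x 1))

/-- Second model coordinate in band coordinates. [folklore] -/
def mW (x : EuclideanSpace ℝ (Fin 2)) : ℝ := W (rr (x 0)) (θw (x 1))

/-- Unfolding `mU`. [folklore] -/
theorem mU_def (x : EuclideanSpace ℝ (Fin 2)) : mU x = U (rr (x 0)) (θw (x 1)) := rfl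
/-- Unfolding `mW`. [folklore] -/
theorem mW_def (x : EuclideanSpace ℝ (Fin 2)) : mW x = W (rr (x 0)) (θw (x 1)) := rfl

/-- `mU` at `(a, b)`. [folklore] -/
@[simp] theorem mU_pt2 (a b : ℝ) : mU (pt2 a b) = U (rr a) (θw b) := rfl
/-- `mW` at `(a, b)`. [folklore] -/
@[simp] theorem mW_pt2 (a b : ℝ) : mW (pt2 a b) = W (rr a) (θw b) := rfl

/-- The coordinate projections of `ℝ²` are smooth. [folklore] -/
theorem contDiff_apply_fin_two (i : Fin 2) : ContDiff ℝ ∞ fun x : EuclideanSpace ℝ (Fin 2) ↦ x i :=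
  (EuclideanSpace.proj (𝕜 := ℝ) i).contDiff

/-- `x ↦ sfl (Q (rr x₀) (θw x₁))` is smooth and nonvanishing, so `mU`, `mW` are smooth. [folklore] -/
theorem contDiff_mU : ContDiff ℝ ∞ mU := by
  unfold mU U
  have h0 := contDiff_apply_fin_two 0
  have h1 := contDiff_apply_fin_two 1
  have hr : ContDiff ℝ ∞ fun x : EuclideanSpace ℝ (Fin 2) ↦ rr (x 0) := contDiff_rr.comp h0
  have hθ : ContDiff ℝ ∞ fun x : EuclideanSpace ℝ (Fin 2) ↦ θw (x 1) := contDiff_θw.comp h1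
  have hQ : ContDiff ℝ ∞ fun x : EuclideanSpace ℝ (Fin 2) ↦ sfl (Q (rr (x 0)) (θw (x 1))) := by
    unfold Q
    exact contDiff_sfl.comp (((hr.pow 2).sub ((contDiff_const.mul hr).mul (contDiff_sin.comp hθ))).add
      contDiff_const)
  exact ((contDiff_const.mul hr).mul (contDiff_cos.comp hθ)).div hQ fun x ↦ sfl_ne_zero _

/-- `mW` is `C^∞`. [folklore] -/
theorem contDiff_mW : ContDiff ℝ ∞ mW := by
  unfold mW W
  have h0 := contDiff_apply_fin_two 0
  have h1 := contDiff_apply_fin_two 1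
  have hr : ContDiff ℝ ∞ fun x : EuclideanSpace ℝ (Fin 2) ↦ rr (x 0) := contDiff_rr.comp h0
  have hθ : ContDiff ℝ ∞ fun x : EuclideanSpace ℝ (Fin 2) ↦ θw (x 1) := contDiff_θw.comp h1
  have hQ : ContDiff ℝ ∞ fun x : EuclideanSpace ℝ (Fin 2) ↦ sfl (Q (rr (x 0)) (θw (x 1))) := by
    unfold Q
    exact contDiff_sfl.comp (((hr.pow 2).sub ((contDiff_const.mul hr).mul (contDiff_sin.comp hθ))).add
      contDiff_const)
  exact contDiff_const.add ((contDiff_const.mul ((hr.mul (contDiff_sin.comp hθ)).sub contDiff_const)).div hQ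
    fun x ↦ sfl_ne_zero _)

/-- `mU` is differentiable. [folklore] -/
theorem differentiable_mU : Differentiable ℝ mU := contDiff_mU.differentiable (by simp)
/-- `mW` is differentiable. [folklore] -/
theorem differentiable_mW : Differentiable ℝ mW := contDiff_mW.differentiable (by simp)

/-- Periodicity of the model in `x₁`. [folklore] -/
theorem mU_add_per (a b : ℝ) : mU (pt2 a (b + per)) = mU (pt2 a b) := by
  simp only [mU_pt2, U, Q, θw_add_per, cos_add_two_pi, sin_add_two_pi]

/-- Periodicity of `mW` in `x₁`. [folklore] -/
theorem mW_add_per (a b : ℝ) : mW (pt2 a (b + per)) = mW (pt2 a b) := by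
  simp only [mW_pt2, W, Q, θw_add_per, sin_add_two_pi]

/-! ### Directional derivatives of the model coordinates -/

/-- The line `τ ↦ x + τ • v` through `x`. [folklore] -/
theorem hasDerivAt_line (x v : EuclideanSpace ℝ (Fin 2)) (τ : ℝ) :
    HasDerivAt (fun t : ℝ ↦ x + t • v) v τ := by
  simpa using ((hasDerivAt_id τ).smul_const v).const_add x

/-- Coordinates along the line `x + t • v`. [folklore] -/
theorem line_apply (x v : EuclideanSpace ℝ (Fin 2)) (t : ℝ) (i : Fin 2) : (x + t • v) i = x i + t * v i := by
  simp

/-- **The differential of `mU`**: `d(mU)_x v = Ur · 9 v₀ + Uθ · κ v₁` on the region. [folklore] -/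
theorem fderiv_mU_apply {x : EuclideanSpace ℝ (Fin 2)} (hQ : 10 < Q (rr (x 0)) (θw (x 1)))
    (v : EuclideanSpace ℝ (Fin 2)) :
    fderiv ℝ mU x v = Ur (rr (x 0)) (θw (x 1)) * (9 * v 0) + Uθ (rr (x 0)) (θw (x 1)) * (kap * v 1) := by
  -- derivative along the line through `x` in direction `v`, computed in two ways
  have hl := hasDerivAt_line x v 0
  have h1 : HasDerivAt (fun t : ℝ ↦ mU (x + t • v)) (fderiv ℝ mU x v) 0 :=
    (differentiable_mU x).hasFDerivAt.comp_hasDerivAt_of_eq (0:ℝ) hl (by simp)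
  have hi0 : HasDerivAt (fun t : ℝ ↦ x 0 + t * v 0) (v 0) 0 := by
    have h := ((hasDerivAt_id (0:ℝ)).mul_const (v 0)).const_add (x 0)
    rwa [one_mul] at h
  have hi1 : HasDerivAt (fun t : ℝ ↦ x 1 + t * v 1) (v 1) 0 := by
    have h := ((hasDerivAt_id (0:ℝ)).mul_const (v 1)).const_add (x 1)
    rwa [one_mul] at h
  have hr : HasDerivAt (fun t : ℝ ↦ rr (x 0 + t * v 0)) (9 * v 0) 0 :=
    (hasDerivAt_rr (x 0)).comp_of_eq (0:ℝ) hi0 (by ring)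
  have hθ : HasDerivAt (fun t : ℝ ↦ θw (x 1 + t * v 1)) (kap * v 1) 0 :=
    (hasDerivAt_θw (x 1)).comp_of_eq (0:ℝ) hi1 (by ring)
  have e0 : x 0 + 0 * v 0 = x 0 := by ring
  have e1 : x 1 + 0 * v 1 = x 1 := by ring
  have hQ' : 10 < Q (rr (x 0 + 0 * v 0)) (θw (x 1 + 0 * v 1)) := by rw [e0, e1]; exact hQ
  have h2 := hasDerivAt_U_comp (r := fun t : ℝ ↦ rr (x 0 + t * v 0)) (θ := fun t : ℝ ↦ θw (x 1 + t * v 1))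
    (t := 0) hQ' hr hθ
  rw [e0, e1] at h2
  have e : ∀ t : ℝ, mU (x + t • v) = U (rr (x 0 + t * v 0)) (θw (x 1 + t * v 1)) := by
    intro t; rw [mU_def, line_apply, line_apply]
  have h1' : HasDerivAt (fun t : ℝ ↦ U (rr (x 0 + t * v 0)) (θw (x 1 + t * v 1))) (fderiv ℝ mU x v) 0 :=
    h1.congr_of_eventuallyEq (Filter.Eventually.of_forall fun t ↦ (e t).symm)
  exact h1'.unique h2

/-- **The differential of `mW`**: `d(mW)_x v = Wr · 9 v₀ + Wθ · κ v₁` on the region. [folklore] -/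
theorem fderiv_mW_apply {x : EuclideanSpace ℝ (Fin 2)} (hQ : 10 < Q (rr (x 0)) (θw (x 1)))
    (v : EuclideanSpace ℝ (Fin 2)) :
    fderiv ℝ mW x v = Wr (rr (x 0)) (θw (x 1)) * (9 * v 0) + Wθ (rr (x 0)) (θw (x 1)) * (kap * v 1) := by
  have hl := hasDerivAt_line x v 0
  have h1 : HasDerivAt (fun t : ℝ ↦ mW (x + t • v)) (fderiv ℝ mW x v) 0 :=
    (differentiable_mW x).hasFDerivAt.comp_hasDerivAt_of_eq (0:ℝ) hl (by simp)
  have hi0 : HasDerivAt (fun t : ℝ ↦ x 0 + t * v 0) (v 0) 0 := by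
    have h := ((hasDerivAt_id (0:ℝ)).mul_const (v 0)).const_add (x 0)
    rwa [one_mul] at h
  have hi1 : HasDerivAt (fun t : ℝ ↦ x 1 + t * v 1) (v 1) 0 := by
    have h := ((hasDerivAt_id (0:ℝ)).mul_const (v 1)).const_add (x 1)
    rwa [one_mul] at h
  have hr : HasDerivAt (fun t : ℝ ↦ rr (x 0 + t * v 0)) (9 * v 0) 0 :=
    (hasDerivAt_rr (x 0)).comp_of_eq (0:ℝ) hi0 (by ring)
  have hθ : HasDerivAt (fun t : ℝ ↦ θw (x 1 + t * v 1)) (kap * v 1) 0 :=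
    (hasDerivAt_θw (x 1)).comp_of_eq (0:ℝ) hi1 (by ring)
  have e0 : x 0 + 0 * v 0 = x 0 := by ring
  have e1 : x 1 + 0 * v 1 = x 1 := by ring
  have hQ' : 10 < Q (rr (x 0 + 0 * v 0)) (θw (x 1 + 0 * v 1)) := by rw [e0, e1]; exact hQ
  have h2 := hasDerivAt_W_comp (r := fun t : ℝ ↦ rr (x 0 + t * v 0)) (θ := fun t : ℝ ↦ θw (x 1 + t * v 1))
    (t := 0) hQ' hr hθ
  rw [e0, e1] at h2
  have e : ∀ t : ℝ, mW (x + t • v) = W (rr (x 0 + t * v 0)) (θw (x 1 + t * v 1)) := by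
    intro t; rw [mW_def, line_apply, line_apply]
  have h1' : HasDerivAt (fun t : ℝ ↦ W (rr (x 0 + t * v 0)) (θw (x 1 + t * v 1))) (fderiv ℝ mW x v) 0 :=
    h1.congr_of_eventuallyEq (Filter.Eventually.of_forall fun t ↦ (e t).symm)
  exact h1'.unique h2

/-- **The model map is an immersion on the region**: if both differentials vanish on `v` then
`v = 0`. [folklore] -/
theorem eq_zero_of_fderiv_eq_zero {x v : EuclideanSpace ℝ (Fin 2)} (hx : -(1 / 10) ≤ x 0)
    (hs : sin (θw (x 1)) ≤ 1 / 2) (hQ : 10 < Q (rr (x 0)) (θw (x 1)))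
    (hU : fderiv ℝ mU x v = 0) (hW : fderiv ℝ mW x v = 0) : v = 0 := by
  rw [fderiv_mU_apply hQ] at hU
  rw [fderiv_mW_apply hQ] at hW
  set r := rr (x 0) with hrdef
  set θ := θw (x 1) with hθdef
  have hr : 0 < r := rr_pos hx
  have hpos := Ur_sq_add_Wr_sq_pos hr hs hQ.le
  rw [Uθ_eq_mul_Wr] at hU
  rw [Wθ_eq_neg_mul_Ur] at hW
  set a := 9 * v 0 with ha
  set b := kap * v 1 with hb
  -- `Ur a + r Wr b = 0`, `Wr a - r Ur b = 0`
  have h1 : (Ur r θ ^ 2 + Wr r θ ^ 2) * a = 0 := by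
    have e1 : Ur r θ * (Ur r θ * a + r * Wr r θ * b) + Wr r θ * (Wr r θ * a + -(r * Ur r θ) * b) = 0 := by
      rw [hU, hW]; ring
    nlinarith [e1]
  have ha0 : a = 0 := by
    rcases mul_eq_zero.1 h1 with h | h
    · exact absurd h hpos.ne'
    · exact h
  have hb0 : b = 0 := by
    rw [ha0, mul_zero, zero_add] at hU
    rw [ha0, mul_zero, zero_add] at hW
    -- `r Wr b = 0` and `-(r Ur) b = 0`
    by_contra hb0
    have h2 : Wr r θ = 0 := by
      have := mul_eq_zero.1 hU
      rcases this with h | h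
      · rcases mul_eq_zero.1 h with h' | h'
        · exact absurd h' hr.ne'
        · exact h'
      · exact absurd h hb0
    have h3 : Ur r θ = 0 := by
      rcases mul_eq_zero.1 hW with h | h
      · rw [neg_eq_zero] at h
        rcases mul_eq_zero.1 h with h' | h'
        · exact absurd h' hr.ne'
        · exact h'
      · exact absurd h hb0
    rw [h2, h3] at hpos
    norm_num at hpos
  ext i
  fin_cases i
  · change v 0 = 0
    have : (9:ℝ) * v 0 = 0 := ha0
    linarith
  · change v 1 = 0
    have : kap * v 1 = 0 := hb0
    rcases mul_eq_zero.1 this with h | h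
    · exact absurd h kap_pos.ne'
    · exact h

/-! ### Injectivity and edges in band coordinates -/

/-- **The model is injective on the enlarged collar**: equal images come from equal `x₀` and
angles congruent modulo `2π`; on the collar (angles less than `2π` apart) equal `x₁`. [folklore] -/
theorem rr_eq_and_of_eq {x y : EuclideanSpace ℝ (Fin 2)} (hx : -(1 / 10) ≤ x 0) (hy : -(1 / 10) ≤ y 0)
    (hQx : 10 ≤ Q (rr (x 0)) (θw (x 1))) (hQy : 10 ≤ Q (rr (y 0)) (θw (y 1)))
    (hU : mU x = mU y) (hW : mW x = mW y) (hθ : |θw (x 1) - θw (y 1)| < 2 * π) : x = y := by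
  obtain ⟨hc, hsn⟩ := polar_eq_of_eq hQx hQy hU hW
  obtain ⟨h0, h1⟩ := eq_of_polar_eq (rr_pos hx) (rr_pos hy) hc hsn hθ
  ext i; fin_cases i
  · change x 0 = y 0
    exact strictMono_rr.injective h0
  · change x 1 = y 1
    exact θw_injective h1

/-- On the enlarged collar the window angles are less than `2π` apart. [folklore] -/
theorem abs_θw_sub_lt {a b : ℝ} (ha : a ∈ Icc (-(1 / 10) - (10 * kap)⁻¹) (11 / 10 + (10 * kap)⁻¹))
    (hb : b ∈ Icc (-(1 / 10) - (10 * kap)⁻¹) (11 / 10 + (10 * kap)⁻¹)) : |θw a - θw b| < 2 * π := by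
  have hk := kap_pos
  have lo : ∀ c ∈ Icc (-(1 / 10) - (10 * kap)⁻¹) (11 / 10 + (10 * kap)⁻¹), θw c ∈ Icc (-π - 1 / 2) (1 / 2) := by
    intro c hc
    have e1 : θw (-(1 / 10) - (10 * kap)⁻¹) = -π - 1 / 2 := by rw [θw]; field_simp; ring
    have e2 : θw (11 / 10 + (10 * kap)⁻¹) = 1 / 2 := by rw [θw, kap]; field_simp; ring
    rw [← e1, ← e2]
    exact ⟨strictMono_θw.monotone hc.1, strictMono_θw.monotone hc.2⟩
  have h1 := lo a ha
  have h2 := lo b hb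
  have hπ := pi_gt_three
  rw [abs_lt]; constructor <;> linarith [h1.1, h1.2, h2.1, h2.2]

/-- **The right edge is on the line**: `mW x = 0 ↔ x₀ = 1` on the region. [folklore] -/
theorem mW_eq_zero_iff {x : EuclideanSpace ℝ (Fin 2)} (hx : -(1 / 10) ≤ x 0)
    (hQ : 10 ≤ Q (rr (x 0)) (θw (x 1))) : mW x = 0 ↔ x 0 = 1 := by
  rw [mW_def, W_eq_zero_iff hQ (rr_pos hx), rr_eq_iff]; norm_num

/-- `mW x < 0 ↔ x₀ < 1`: the open band below the right edge lies below the line. [folklore] -/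
theorem mW_neg_iff {x : EuclideanSpace ℝ (Fin 2)} (hx : -(1 / 10) ≤ x 0)
    (hQ : 10 ≤ Q (rr (x 0)) (θw (x 1))) : mW x < 0 ↔ x 0 < 1 := by
  rw [mW_def, W_neg_iff hQ (rr_pos hx), rr]; constructor <;> intro h <;> linarith

/-- `0 < mW x ↔ 1 < x₀`: the collar beyond the right edge lies above the line. [folklore] -/
theorem mW_pos_iff {x : EuclideanSpace ℝ (Fin 2)} (hx : -(1 / 10) ≤ x 0)
    (hQ : 10 ≤ Q (rr (x 0)) (θw (x 1))) : 0 < mW x ↔ 1 < x 0 := by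
  rw [mW_def, W_pos_iff hQ (rr_pos hx), rr]; constructor <;> intro h <;> linarith

/-- **The left edge is on the round circle** `O_c` (centre `(0, -1010/99)`, radius `200/99`), and
conversely a point of the region is on `O_c` only if `x₀ = 0`. [folklore] -/
theorem mem_circle_iff {x : EuclideanSpace ℝ (Fin 2)} (hx : -(1 / 10) ≤ x 0)
    (hQ : 10 ≤ Q (rr (x 0)) (θw (x 1))) :
    mU x ^ 2 + (mW x + 1010 / 99) ^ 2 = (200 / 99) ^ 2 ↔ x 0 = 0 := by
  have hQ0 : 0 < Q (rr (x 0)) (θw (x 1)) := by linarith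
  have h := inversion_identity (ρ := 1) hQ (by norm_num)
  have e1 : (10 : ℝ) * (1 - 200 / (100 - 1 ^ 2)) = -(1010 / 99) := by norm_num
  have e2 : (200 : ℝ) * 1 / (100 - 1 ^ 2) = 200 / 99 := by norm_num
  rw [e1, e2, sub_neg_eq_add] at h
  rw [mU_def, mW_def, h, add_eq_left, div_eq_zero_iff]
  have hr := rr_pos hx
  constructor
  · rintro (h | h)
    · have : (rr (x 0) - 1) * (rr (x 0) + 1) = 0 := by nlinarith
      rcases mul_eq_zero.1 this with h' | h'
      · rw [rr] at h'; linarith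
      · linarith
    · nlinarith
  · intro h0; left; rw [h0, rr_zero]; norm_num

/-- The circle `O_c` itself: `mU (0, b)`, `mW (0, b)` lie on it for every `b`. [folklore] -/
theorem pt2_zero_mem_circle (b : ℝ) : mU (pt2 0 b) ^ 2 + (mW (pt2 0 b) + 1010 / 99) ^ 2 = (200 / 99) ^ 2 := by
  rw [mU_pt2, mW_pt2, rr_zero]; exact circle_identity _

/-- **The band crosses the splitting circle exactly in its middle line** `x₀ = 1/2`. [folklore] -/
theorem mem_splitCircle_iff {x : EuclideanSpace ℝ (Fin 2)} (hx : -(1 / 10) ≤ x 0)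
    (hQ : 10 ≤ Q (rr (x 0)) (θw (x 1))) :
    mU x ^ 2 + (mW x - 10 * (1 - 800 / 279)) ^ 2 = (4400 / 279) ^ 2 ↔ x 0 = 2⁻¹ := by
  rw [mU_def, mW_def, mem_sphere_iff hQ (rr_pos hx), rr_eq_iff]; norm_num

/-- The left edge (and the whole unit circle) lies inside the splitting circle. [folklore] -/
theorem pt2_zero_inside (b : ℝ) :
    mU (pt2 0 b) ^ 2 + (mW (pt2 0 b) - 10 * (1 - 800 / 279)) ^ 2 < (4400 / 279) ^ 2 := by
  rw [mU_pt2, mW_pt2, rr_zero]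
  have hQ : 10 ≤ Q 1 (θw b) := by have := Q_ge_of_le_one (r := 1) (by norm_num) le_rfl (θ := θw b); linarith
  exact (inside_sphere_iff hQ one_pos).2 (by norm_num)

/-- **The right edge**: `x₀ = 1` gives the point `(10 cos θ/(1 - sin θ), 0)` of the line. [folklore] -/
theorem mW_pt2_one {b : ℝ} (hs : sin (θw b) ≤ 1 / 2) : mW (pt2 1 b) = 0 := by
  rw [mW_pt2, rr_one]
  exact (W_eq_zero_iff (ten_le_Q (by norm_num) hs) (by norm_num)).2 rfl

/-- The right edge: `mU (1, b) = 10 cos θ/(1 - sin θ)`, `θ = θ(b)`. [folklore] -/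
theorem mU_pt2_one {b : ℝ} (hs : sin (θw b) ≤ 1 / 2) :
    mU (pt2 1 b) = 10 * cos (θw b) / (1 - sin (θw b)) := by
  rw [mU_pt2, rr_one, U_eq (ten_le_Q (by norm_num) hs), Q]
  have h1 : (1 : ℝ) - sin (θw b) ≠ 0 := by linarith
  have h2 : (10 : ℝ) ^ 2 - 20 * 10 * sin (θw b) + 100 ≠ 0 := by nlinarith
  rw [div_eq_div_iff h2 h1]
  ring

/-- Along the right edge `mU (1, ·)` is strictly increasing (on the enlarged collar). [folklore] -/
theorem strictMonoOn_mU_one :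
    StrictMonoOn (fun b ↦ mU (pt2 1 b)) (Icc (-(1 / 10) - (10 * kap)⁻¹) (11 / 10 + (10 * kap)⁻¹)) := by
  refine strictMonoOn_of_deriv_pos (convex_Icc _ _) ?_ ?_
  · exact (contDiff_mU.continuous.comp (by fun_prop : Continuous fun b : ℝ ↦ pt2 1 b)).continuousOn
  · intro b hb
    rw [interior_Icc] at hb
    have hs : sin (θw b) ≤ 1 / 2 := sin_θw_le ⟨hb.1.le, hb.2.le⟩
    have h := hasDerivAt_U_ten (θ := θw) hs (hasDerivAt_θw b)
    have e : (fun b ↦ mU (pt2 1 b)) = fun b ↦ U 10 (θw b) := by funext b; rw [mU_pt2, rr_one]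
    rw [e, h.deriv]
    exact mul_pos (Uθ_ten_pos hs) kap_pos

/-! ### The packaged planar model map -/

/-- **The planar model band map** `x ↦ (mU x, mW x)`. [folklore] -/
def mpt (x : EuclideanSpace ℝ (Fin 2)) : EuclideanSpace ℝ (Fin 2) :=
  mU x • EuclideanSpace.single 0 1 + mW x • EuclideanSpace.single 1 1

/-- First coordinate of the model map. [folklore] -/
@[simp] theorem mpt_apply_zero (x : EuclideanSpace ℝ (Fin 2)) : mpt x 0 = mU x := by
  simp [mpt]

/-- Second coordinate of the model map. [folklore] -/
@[simp] theorem mpt_apply_one (x : EuclideanSpace ℝ (Fin 2)) : mpt x 1 = mW x := by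
  simp [mpt]

/-- The model map in the `pt2` form. [folklore] -/
theorem mpt_eq_pt2 (x : EuclideanSpace ℝ (Fin 2)) : mpt x = pt2 (mU x) (mW x) := by
  ext i; fin_cases i <;> simp

/-- The model map is `C^∞`. [folklore] -/
theorem contDiff_mpt : ContDiff ℝ ∞ mpt :=
  (contDiff_mU.smul contDiff_const).add (contDiff_mW.smul contDiff_const)

/-- The model map is differentiable. [folklore] -/
theorem differentiable_mpt : Differentiable ℝ mpt := contDiff_mpt.differentiable (by simp)

/-- The differential of the model map on a vector, coordinatewise. [folklore] -/
theorem fderiv_mpt_apply (x v : EuclideanSpace ℝ (Fin 2)) :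
    fderiv ℝ mpt x v = fderiv ℝ mU x v • EuclideanSpace.single 0 1 + fderiv ℝ mW x v • EuclideanSpace.single 1 1 := by
  have h : HasFDerivAt mpt ((fderiv ℝ mU x).smulRight (EuclideanSpace.single 0 1) +
      (fderiv ℝ mW x).smulRight (EuclideanSpace.single 1 1)) x :=
    ((differentiable_mU x).hasFDerivAt.smul_const _).add ((differentiable_mW x).hasFDerivAt.smul_const _)
  rw [h.fderiv]
  rfl

/-- **The model map is an immersion on the region.** [folklore] -/
theorem injective_fderiv_mpt {x : EuclideanSpace ℝ (Fin 2)} (hx : -(1 / 10) ≤ x 0)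
    (hs : sin (θw (x 1)) ≤ 1 / 2) (hQ : 10 < Q (rr (x 0)) (θw (x 1))) : Injective (fderiv ℝ mpt x) := by
  refine (injective_iff_map_eq_zero _).2 fun v hv ↦ ?_
  have hv' : fderiv ℝ mpt x v = 0 := hv
  rw [fderiv_mpt_apply] at hv'
  have h0 := congrArg (fun z : EuclideanSpace ℝ (Fin 2) ↦ z 0) hv'
  have h1 := congrArg (fun z : EuclideanSpace ℝ (Fin 2) ↦ z 1) hv'
  simp at h0 h1
  exact eq_zero_of_fderiv_eq_zero hx hs hQ h0 h1

/-- **The model map is injective on the closed collar** (in fact on the enlarged one). [folklore] -/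
theorem mpt_injOn_aux {x y : EuclideanSpace ℝ (Fin 2)}
    (hx0 : x 0 ∈ Icc (-(1 / 10)) (11 / 10)) (hy0 : y 0 ∈ Icc (-(1 / 10)) (11 / 10))
    (hx1 : x 1 ∈ Icc (-(1 / 10) - (10 * kap)⁻¹) (11 / 10 + (10 * kap)⁻¹))
    (hy1 : y 1 ∈ Icc (-(1 / 10) - (10 * kap)⁻¹) (11 / 10 + (10 * kap)⁻¹)) (h : mpt x = mpt y) : x = y := by
  have hsx := sin_θw_le hx1
  have hsy := sin_θw_le hy1
  have hU : mU x = mU y := by simpa using congrArg (fun z : EuclideanSpace ℝ (Fin 2) ↦ z 0) h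
  have hW : mW x = mW y := by simpa using congrArg (fun z : EuclideanSpace ℝ (Fin 2) ↦ z 1) h
  exact rr_eq_and_of_eq hx0.1 hy0.1 (ten_lt_Q_rr hx0 hsx).le (ten_lt_Q_rr hy0 hsy).le hU hW
    (abs_θw_sub_lt hx1 hy1)

/-- **Equal images come from the same radius and congruent angles**: for two points of the
region with `x₀ ≥ -1/10`, `mpt z = mpt y` forces `z₀ = y₀` and `z₁ ≡ y₁` modulo the period. [folklore] -/
theorem eq_and_congr_of_mpt_eq {y z : EuclideanSpace ℝ (Fin 2)} (hy : -(1 / 10) ≤ y 0) (hz : -(1 / 10) ≤ z 0)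
    (hQy : 10 ≤ Q (rr (y 0)) (θw (y 1))) (hQz : 10 ≤ Q (rr (z 0)) (θw (z 1))) (h : mpt z = mpt y) :
    z 0 = y 0 ∧ ∃ n : ℤ, z 1 = y 1 + n * per := by
  have hU : mU z = mU y := by simpa using congrArg (fun w : EuclideanSpace ℝ (Fin 2) ↦ w 0) h
  have hW : mW z = mW y := by simpa using congrArg (fun w : EuclideanSpace ℝ (Fin 2) ↦ w 1) h
  obtain ⟨hc, hs⟩ := polar_eq_of_eq hQz hQy hU hW
  set r := rr (z 0) with hr
  set r' := rr (y 0) with hr'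
  set θ := θw (z 1) with hθ
  set θ' := θw (y 1) with hθ'
  have hrp : 0 < r := rr_pos hz
  have hrp' : 0 < r' := rr_pos hy
  have hsq : r ^ 2 = r' ^ 2 := by
    have h1 : (r * cos θ) ^ 2 + (r * sin θ) ^ 2 = r ^ 2 := by nlinarith [sin_sq_add_cos_sq θ]
    have h2 : (r' * cos θ') ^ 2 + (r' * sin θ') ^ 2 = r' ^ 2 := by nlinarith [sin_sq_add_cos_sq θ']
    rw [← h1, ← h2, hc, hs]
  have hrr : r = r' := by nlinarith [sq_nonneg (r - r'), sq_nonneg (r + r')]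
  have h0 : z 0 = y 0 := strictMono_rr.injective hrr
  refine ⟨h0, ?_⟩
  rw [hrr] at hc hs
  have hc' : cos θ = cos θ' := mul_left_cancel₀ hrp'.ne' hc
  have hs' : sin θ = sin θ' := mul_left_cancel₀ hrp'.ne' hs
  have h1 : cos (θ - θ') = 1 := by
    rw [cos_sub, hc', hs']; nlinarith [sin_sq_add_cos_sq θ']
  obtain ⟨n, hn⟩ := (cos_eq_one_iff _).1 h1
  refine ⟨n, ?_⟩
  -- `θw (z 1) - θw (y 1) = κ (z 1 - y 1) = n · 2π`
  have e : θ - θ' = kap * (z 1 - y 1) := by rw [hθ, hθ', θw, θw]; ring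
  rw [e] at hn
  rw [per]
  have hk := kap_pos.ne'
  field_simp
  linarith

/-! ### Trigonometry of the two windows -/

/-- `sin (-π - x) = sin x`. [folklore] -/
theorem sin_neg_pi_sub (x : ℝ) : sin (-π - x) = sin x := by
  rw [show -π - x = -(x + π) by ring, sin_neg, sin_add_pi, neg_neg]

/-- `cos (-π - x) = -cos x`. [folklore] -/
theorem cos_neg_pi_sub (x : ℝ) : cos (-π - x) = -cos x := by
  rw [show -π - x = -(x + π) by ring, cos_neg, cos_add_pi]

/-- On `[0, 1/2]`: `cos θ > 0`. [folklore] -/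
theorem cos_pos_right {θ : ℝ} (h1 : 0 ≤ θ) (h2 : θ ≤ 1 / 2) : 0 < cos θ :=
  cos_pos_of_abs_lt (by rw [abs_of_nonneg h1]; linarith)

/-- On the right window `[7/20, 1/2]`: `sin θ ≥ 339/1000`. [folklore] -/
theorem sin_ge_right {θ : ℝ} (h1 : 7 / 20 ≤ θ) (h2 : θ ≤ 1 / 2) : 339 / 1000 ≤ sin θ := by
  have h := lt_sin_seven_twentieths
  have : sin (7 / 20) ≤ sin θ :=
    sin_le_sin_of_le_of_le_pi_div_two (by linarith [pi_gt_three]) (by linarith [pi_gt_three]) h1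
  linarith

/-- On the left window `[-π - 1/2, -π]`: `cos θ < 0`. [folklore] -/
theorem cos_neg_left {θ : ℝ} (h1 : -π - 1 / 2 ≤ θ) (h2 : θ ≤ -π) : cos θ < 0 := by
  have e : cos θ = -cos (-π - θ) := by rw [cos_neg_pi_sub, neg_neg]
  rw [e, neg_lt_zero]
  exact cos_pos_of_abs_lt (by rw [abs_lt]; constructor <;> linarith)

/-- On the left window `[-π - 1/2, -π - 7/20]`: `sin θ ≥ 339/1000`. [folklore] -/
theorem sin_ge_left {θ : ℝ} (h1 : -π - 1 / 2 ≤ θ) (h2 : θ ≤ -π - 7 / 20) : 339 / 1000 ≤ sin θ := by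
  have e : sin θ = sin (-π - θ) := by rw [sin_neg_pi_sub]
  rw [e]
  exact sin_ge_right (by linarith) (by linarith)

/-- On the closed collar window `[-π - 2/5, 2/5]`: `sin θ ≤ 2/5`. [folklore] -/
theorem sin_le_two_fifths {θ : ℝ} (h1 : -π - 2 / 5 ≤ θ) (h2 : θ ≤ 2 / 5) : sin θ ≤ 2 / 5 := by
  have h25 : sin (2 / 5 : ℝ) ≤ 2 / 5 := sin_two_fifths_lt.le
  rcases le_or_gt 0 θ with h | h
  · calc sin θ ≤ sin (2 / 5) := sin_le_sin_of_le_of_le_pi_div_two (by linarith [pi_pos])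
          (by linarith [pi_gt_three]) h2
      _ ≤ 2 / 5 := h25
  · rcases le_or_gt (-π) θ with h' | h'
    · have := sin_nonpos_of_nonpos_of_neg_pi_le h.le h'
      linarith
    · rw [← sin_neg_pi_sub θ]
      calc sin (-π - θ) ≤ sin (2 / 5) := sin_le_sin_of_le_of_le_pi_div_two (by linarith [pi_pos])
            (by linarith [pi_gt_three]) (by linarith)
        _ ≤ 2 / 5 := h25

/-- The sine of the window angle on the closed collar is at most `2/5`. [folklore] -/
theorem sin_θw_le_two_fifths {x₁ : ℝ} (h : x₁ ∈ Icc (-(1 / 10)) (11 / 10)) : sin (θw x₁) ≤ 2 / 5 :=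
  let hm := θw_mem h
  sin_le_two_fifths hm.1 hm.2

end Polar

end BandSumUnit

end Literature.Topology.FourManifolds
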